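import Summits.QuantumFields.YangMills.Theorems.FemtoTransferGap
import Literature.MathematicalPhysics.QuantumLattice.SU2Haar
import Literature.LinearAlgebra.Matrix.SU2MovesLines

/-!
# Physical (gauge- and zero-flux-invariant) class functions of the one-site `SU(2)` model: the centre of `SU(2)` and functions of `|Re tr U_k|`
# (support module for the registered stubs of crux `OneSiteLevels`, route `LuscherReduction`, item stmt-QuantumFields-20007;
# fleet lead prover ym-luscher-20007-p1)

Every concrete test function of the one-site crux — the IMS cut-offs `J_a` of the localisation step of `stub_oneSiteEnergyLower`
(`Theorems/LuscherReductionOneSiteLevelsIMS.lean` asks them to be gauge- and twist-invariant), the `λ_b`-wide trial states of the quasimode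
floors (`stub_oneSiteEnergyUpper`, rung `stub_rungW1up`) — is a function of the three link traces that must be PHYSICAL in the sense of
`IsPhys` (`Theorems.FemtoTransferGap`: bounded, measurable, invariant under gauge transformations and under the three centre twists).  At `L = 1`
a gauge transformation conjugates every link by the same group element (`gaugeTransform_one_site`), so any function of the traces is gauge
invariant; a centre twist multiplies one link by a central `z`, and **the centre of `SU(2)` is `{±1}`** (`coe_eq_one_or_neg_one_of_mem_center`,
Schur: `z` commutes with `diag(i,−i)` and with the quarter turn), so `|Re tr(zU)| = |Re tr U|` (`abs_re_trace_center_mul`).  Hence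
(`isPhys_absTraceFun`): for every bounded measurable `F : (Edge 3 1 → ℝ) → ℝ`, the function `U ↦ F(|Re tr U_e|)_e` is physical.

## WHAT THIS IS NOT
No analysis; no statement about transfer values; NOT the crux, NOT THE CLAY GAP.  Sorry-free; no new definition, no named fact.
-/

set_option autoImplicit false

noncomputable section

open Matrix
open scoped ComplexConjugate
open Literature.MathematicalPhysics.QuantumFieldTheory
open Literature.MathematicalPhysics.QuantumLattice

namespace Summit.QuantumFields.YangMills.Theorems.FemtoTransferGap

/-! ### §1. The centre of `SU(2)` is `{±1}` -/

/-- **The centre of `SU(2)` is `{±1}`**: a central `z ∈ SU(2)` is `1` or `−1` as a matrix (it commutes with `diag(i,−i)`, forcing the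
off-diagonal entry to vanish, and with the quarter turn `[[0,−1],[1,0]]`, forcing `z₀₀` to be real; `|z₀₀| = 1`; the two witnesses are the
tree's `SU2Line.phase_mem_SU2` / `quarterTurn_mem_SU2`). [cite: BrockerTomDieck1985, I (1.10)] -/
theorem coe_eq_one_or_neg_one_of_mem_center {z : SU2} (hz : z ∈ Subgroup.center SU2) :
    (z : Matrix (Fin 2) (Fin 2) ℂ) = 1 ∨ (z : Matrix (Fin 2) (Fin 2) ℂ) = -1 := by
  rw [Subgroup.mem_center_iff] at hz
  have h11 := su2_apply_11 z
  have h10 := su2_apply_10 z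
  set a := (z : Matrix (Fin 2) (Fin 2) ℂ) 0 0 with ha
  set b := (z : Matrix (Fin 2) (Fin 2) ℂ) 0 1 with hb
  have hzm : (z : Matrix (Fin 2) (Fin 2) ℂ) = !![a, b; -conj b, conj a] := by
    rw [← h11, ← h10]; exact Matrix.eta_fin_two _
  have hnorm : a.re ^ 2 + a.im ^ 2 + b.re ^ 2 + b.im ^ 2 = 1 := by
    have h := normSq_su2Quat z
    rw [Quaternion.normSq_def'] at h
    simp only [su2Quat] at h
    nlinarith [h]
  -- commutation with `diag(i, −i)`
  have hI := congrArg (fun g : SU2 => (g : Matrix (Fin 2) (Fin 2) ℂ)) (hz ⟨_, Literature.LinearAlgebra.Matrix.SU2Line.phase_mem_SU2⟩)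
  simp only [Submonoid.coe_mul] at hI
  rw [hzm] at hI
  simp only [Matrix.mul_fin_two] at hI
  have hb0 : b = 0 := by
    have h := congr_fun (congr_fun hI 0) 1
    simp only [Matrix.of_apply, Matrix.cons_val', Matrix.cons_val_zero, Matrix.cons_val_one, Matrix.empty_val',
      Matrix.cons_val_fin_one] at h
    have h' : (2 * Complex.I) * b = 0 := by linear_combination h
    rcases mul_eq_zero.1 h' with h2 | h2
    · exfalso; apply Complex.I_ne_zero
      have : (2 : ℂ) ≠ 0 := two_ne_zero
      exact (mul_eq_zero.1 h2).resolve_left this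
    · exact h2
  -- commutation with the real rotation
  have hJ := congrArg (fun g : SU2 => (g : Matrix (Fin 2) (Fin 2) ℂ)) (hz ⟨_, Literature.LinearAlgebra.Matrix.SU2Line.quarterTurn_mem_SU2⟩)
  simp only [Submonoid.coe_mul] at hJ
  rw [hzm] at hJ
  simp only [Matrix.mul_fin_two] at hJ
  have haim : a.im = 0 := by
    have h := congr_fun (congr_fun hJ 0) 1
    simp only [Matrix.of_apply, Matrix.cons_val', Matrix.cons_val_zero, Matrix.cons_val_one, Matrix.empty_val',
      Matrix.cons_val_fin_one, hb0] at h
    have h' : conj a = a := by linear_combination (-1 : ℂ) * h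
    have := congrArg Complex.im h'
    rw [Complex.conj_im] at this
    linarith
  have hb_re : b.re = 0 := by rw [hb0]; simp
  have hb_im : b.im = 0 := by rw [hb0]; simp
  rw [haim, hb_re, hb_im] at hnorm
  have hsq : (a.re - 1) * (a.re + 1) = 0 := by nlinarith [hnorm]
  have ha_eq : a = (a.re : ℂ) := Complex.ext (by simp) (by simp [haim])
  rcases mul_eq_zero.1 hsq with h | h
  · left
    have har : a.re = 1 := by linarith
    rw [hzm, hb0, ha_eq, har]
    ext i j
    fin_cases i <;> fin_cases j <;> simp
  · right
    have har : a.re = -1 := by linarith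
    rw [hzm, hb0, ha_eq, har]
    ext i j
    fin_cases i <;> fin_cases j <;> simp

/-- A central element of `SU(2)` does not change `|Re tr|`: `|Re tr(zU)| = |Re tr U|`. [cite: BrockerTomDieck1985, I (1.10)] -/
theorem abs_re_trace_center_mul {z : SU2} (hz : z ∈ Subgroup.center SU2) (U : SU2) :
    |(((z * U : SU2) : Matrix (Fin 2) (Fin 2) ℂ).trace).re| = |((U : Matrix (Fin 2) (Fin 2) ℂ).trace).re| := by
  rw [Submonoid.coe_mul]
  rcases coe_eq_one_or_neg_one_of_mem_center hz with h | h
  · rw [h, Matrix.one_mul]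
  · rw [h, neg_mul, Matrix.one_mul, Matrix.trace_neg, Complex.neg_re, abs_neg]

/-! ### §2. One-site gauge transformations and twists act on the link traces trivially (up to sign) -/

/-- At `L = 1` a gauge transformation conjugates every link by the SAME element `g(x)` (one site; the shift is the identity). [folklore] -/
theorem gaugeTransform_one_site {G : Type*} [Group G] (g : Site 3 1 → G) (U : GaugeConfig 3 1 G) (e : Edge 3 1) :
    gaugeTransform g U e = g e.1 * U e * (g e.1)⁻¹ := by
  unfold gaugeTransform
  rw [show e.1.shift e.2 = e.1 from Subsingleton.elim _ _]

/-- The link traces are gauge invariant at `L = 1` (cyclicity of the trace). [folklore] -/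
theorem re_trace_gaugeTransform_one_site (g : Site 3 1 → SU2) (U : GaugeConfig 3 1 SU2) (e : Edge 3 1) :
    (((gaugeTransform g U e : SU2) : Matrix (Fin 2) (Fin 2) ℂ).trace).re
      = ((U e : Matrix (Fin 2) (Fin 2) ℂ).trace).re := by
  rw [gaugeTransform_one_site, Submonoid.coe_mul, Submonoid.coe_mul, Matrix.trace_mul_cycle, ← Submonoid.coe_mul,
    inv_mul_cancel, OneMemClass.coe_one, Matrix.one_mul]

/-- A centre twist multiplies a link by the central element or leaves it alone. [folklore] -/
theorem twist_apply_eq_or {G : Type*} [Group G] {L : ℕ} (k : Fin 3) (z : G) (U : GaugeConfig 3 L G) (e : Edge 3 L) :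
    twist k z U e = z * U e ∨ twist k z U e = U e := by
  unfold twist
  split_ifs
  · exact Or.inl rfl
  · exact Or.inr rfl

/-- The absolute link traces `|Re tr U_e|` are twist invariant (`SU(2)`, any `L`). [cite: tHooft1979] -/
theorem abs_re_trace_twist (k : Fin 3) {z : SU2} (hz : z ∈ Subgroup.center SU2) {L : ℕ} (U : GaugeConfig 3 L SU2) (e : Edge 3 L) :
    |(((twist k z U e : SU2) : Matrix (Fin 2) (Fin 2) ℂ).trace).re| = |((U e : Matrix (Fin 2) (Fin 2) ℂ).trace).re| := by
  rcases twist_apply_eq_or k z U e with h | h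
  · rw [h]; exact abs_re_trace_center_mul hz (U e)
  · rw [h]

/-! ### §3. Functions of the absolute link traces are physical -/

/-- Gauge invariance of any function of the link traces at `L = 1`. [folklore] -/
theorem traceFun_gaugeInv {α : Type*} (F : (Edge 3 1 → ℝ) → α) (g : Site 3 1 → SU2) (U : GaugeConfig 3 1 SU2) :
    F (fun e => (((gaugeTransform g U e : SU2) : Matrix (Fin 2) (Fin 2) ℂ).trace).re)
      = F (fun e => ((U e : Matrix (Fin 2) (Fin 2) ℂ).trace).re) := by
  congr 1
  funext e
  exact re_trace_gaugeTransform_one_site g U e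

/-- Gauge invariance of any function of the ABSOLUTE link traces at `L = 1`. [folklore] -/
theorem absTraceFun_gaugeInv {α : Type*} (F : (Edge 3 1 → ℝ) → α) (g : Site 3 1 → SU2) (U : GaugeConfig 3 1 SU2) :
    F (fun e => |(((gaugeTransform g U e : SU2) : Matrix (Fin 2) (Fin 2) ℂ).trace).re|)
      = F (fun e => |((U e : Matrix (Fin 2) (Fin 2) ℂ).trace).re|) := by
  congr 1
  funext e
  rw [re_trace_gaugeTransform_one_site g U e]

/-- Twist (zero-flux) invariance of any function of the absolute link traces (`SU(2)`, any `L`). [cite: tHooft1979] -/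
theorem absTraceFun_twistInv {α : Type*} {L : ℕ} (F : (Edge 3 L → ℝ) → α) (k : Fin 3) {z : SU2} (hz : z ∈ Subgroup.center SU2)
    (U : GaugeConfig 3 L SU2) :
    F (fun e => |(((twist k z U e : SU2) : Matrix (Fin 2) (Fin 2) ℂ).trace).re|)
      = F (fun e => |((U e : Matrix (Fin 2) (Fin 2) ℂ).trace).re|) := by
  congr 1
  funext e
  exact abs_re_trace_twist k hz U e

/-- The vector of absolute link traces depends continuously on the configuration. [folklore] -/
theorem continuous_absTraceVec {L : ℕ} :
    Continuous fun U : GaugeConfig 3 L SU2 => fun e : Edge 3 L => |((U e : Matrix (Fin 2) (Fin 2) ℂ).trace).re| := by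
  refine continuous_pi fun e => ?_
  have h1 : Continuous fun U : GaugeConfig 3 L SU2 => ((U e : SU2) : Matrix (Fin 2) (Fin 2) ℂ) :=
    continuous_subtype_val.comp (continuous_apply e)
  exact ((Complex.continuous_re.comp h1.matrix_trace)).abs

/-- **Functions of the absolute link traces are physical.**  For every bounded measurable `F : (Edge 3 1 → ℝ) → ℝ`, the one-site test
function `U ↦ F((|Re tr U_e|)_e)` is `IsPhys`: bounded, measurable, gauge invariant (conjugation) and zero-flux (centre `{±1}`).  This covers
the IMS cut-offs of the localisation step and the centre-symmetric trial states of the quasimode steps of crux `OneSiteLevels`.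
[cite: Luscher1983, §2] [cite: tHooft1979] -/
theorem isPhys_absTraceFun (F : (Edge 3 1 → ℝ) → ℝ) (hF : Measurable F) {C : ℝ} (hC : ∀ v, |F v| ≤ C) :
    IsPhys (fun U : GaugeConfig 3 1 SU2 => F (fun e => |((U e : Matrix (Fin 2) (Fin 2) ℂ).trace).re|)) where
  measurable := by
    have hcoord : ∀ e : Edge 3 1, Measurable fun U : GaugeConfig 3 1 SU2 => |((U e : Matrix (Fin 2) (Fin 2) ℂ).trace).re| := by
      intro e
      have h1 : Measurable fun W : SU2 => |((W : Matrix (Fin 2) (Fin 2) ℂ).trace).re| :=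
        (Complex.continuous_re.comp continuous_subtype_val.matrix_trace).measurable.abs
      exact h1.comp (measurable_pi_apply e)
    exact hF.comp (measurable_pi_lambda _ hcoord)
  bounded := ⟨C, fun U => hC _⟩
  gaugeInv := fun g U => absTraceFun_gaugeInv F g U
  zeroFlux := fun k z hz U => absTraceFun_twistInv F k hz U

end Summit.QuantumFields.YangMills.Theorems.FemtoTransferGap

end
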